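import Literature.MathematicalPhysics.QuantumLattice.FreeFermionSectorEnergyDeviation
import HarnessLib

/-!
# Exact bathtub identity: the free energy excess pays for every deviation from a Fermi sea

Family `hubbard` / topic `MathematicalPhysics/QuantumLattice`; sharpening of
`FreeFermionSectorEnergyDeviation.lean` (there: the SMEARING form
`Σ_k |ε_k - ε_F| x_k(1 - x_k) ≤ Re⟨ψ, H₀ψ⟩ - minEnergyOn`). Here the exact deviation form:

* `sum_abs_sub_mul_deviation_eq` (abstract bathtub identity): if `0 ≤ x ≤ 1` sums to `|F|` and
  `ε_F` separates `F` from its complement, `Σ_k |ε_k - ε_F| dev_k = Σ_k ε_k x_k - Σ_{k∈F} ε_k` with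
  `dev_k = 1 - x_k` on `F` (holes) and `x_k` off `F` (particles);
* `exists_fermiSet_deviation_le_energy_excess`: for `L ≥ 3` and a unit `ψ ∈ szSector (2n) 0` of the
  fermionic torus there are a Fermi set `F` of `n` momenta and its level `ε_F` with
  `Σ_k |ε_L(k) - ε_F| dev_k ≤ Re ⟨ψ, H₀ ψ⟩ - minEnergyOn H₀ (szSector (2n) 0)`, `H₀ = hubbardTorus 2 L 1 0`,
  `x_k = Re⟨ψ, n_{k↑}ψ⟩` (identity for `↑`, plain bathtub bound for `↓`, paired trial state).

Since `x(1-x) ≤ min(x, 1-x)`, this dominates the smearing form; it is the input of the `a^{3/2}`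
pairing-cost rate (`FreeFermiGasPairingCostOptimal.lean`).

Sources: E. H. Lieb, M. Loss, Analysis, 2nd ed. (AMS 2001), Thm 1.14 (bathtub principle);
J. Bardeen, L. N. Cooper, J. R. Schrieffer, Phys. Rev. 108 (1957) 1175, §II. Folklore
finite-dimensional statements; no named facts, no definitions.

## Mathlib / tree search

Tree: `exists_fermiSet`, `sum_fermiSet_le`, `sum_fermiSet_add_deviation_le` (smearing form),
`minEnergyOn_szSector_hubbardTorus_zero_le`, `sum_re_expect_momentumNumber_up/down`,
`hubbardTorusWith_zero_eq_sum_pairBlock_kinetic`, `re_expect_momentumNumber_mem_Icc`.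
Mathlib: `Finset.sum_ite_mem`, `Finset.sum_sub_distrib`, `Equiv.sum_comp`.
-/

noncomputable section

namespace Literature.MathematicalPhysics.QuantumLattice

open Matrix Finset Literature.Probability.LatticeModels
open scoped ComplexOrder ComplexConjugate

/-! ### The exact bathtub identity with deviations -/

section Bathtub

variable {ι : Type*} [Fintype ι] [DecidableEq ι]

/-- **Exact bathtub identity.** If `Σ_k x_k = |F|` and `ε_F` separates the levels of `F` (below)
from the others (above), then
`Σ_k |ε_k - ε_F| · dev_k = Σ_k ε_k x_k - Σ_{k∈F} ε_k` with `dev_k = 1 - x_k` on `F` and `x_k` off `F`: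
every particle above and every hole below the Fermi set costs exactly its distance to the Fermi
level. Lieb–Loss (2001) Thm 1.14; Bardeen–Cooper–Schrieffer (1957) §II. [folklore] -/
theorem sum_abs_sub_mul_deviation_eq (ε x : ι → ℝ) (F : Finset ι) (eF : ℝ)
    (hF : ∀ k ∈ F, ε k ≤ eF) (hF' : ∀ k ∉ F, eF ≤ ε k) (hsum : ∑ k, x k = F.card) :
    ∑ k, |ε k - eF| * (if k ∈ F then 1 - x k else x k) = ∑ k, ε k * x k - ∑ k ∈ F, ε k := by
  have key : ∀ k, |ε k - eF| * (if k ∈ F then 1 - x k else x k) =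
      (ε k - eF) * x k - (if k ∈ F then ε k - eF else 0) := by
    intro k
    by_cases hk : k ∈ F
    · rw [if_pos hk, if_pos hk, abs_of_nonpos (by linarith [hF k hk])]
      ring
    · rw [if_neg hk, if_neg hk, abs_of_nonneg (by linarith [hF' k hk]), sub_zero]
  rw [Finset.sum_congr rfl fun k _ => key k, Finset.sum_sub_distrib, Finset.sum_ite_mem,
    Finset.univ_inter]
  have e1 : ∑ k, (ε k - eF) * x k = ∑ k, ε k * x k - eF * F.card := by
    rw [← hsum, Finset.mul_sum, ← Finset.sum_sub_distrib]
    exact Finset.sum_congr rfl fun k _ => by ring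
  have e2 : ∑ k ∈ F, (ε k - eF) = ∑ k ∈ F, ε k - eF * F.card := by
    rw [Finset.sum_sub_distrib, Finset.sum_const, nsmul_eq_mul, mul_comm]
  rw [e1, e2]
  ring

end Bathtub

/-! ### The energy excess controls the occupation deviations (exact form) -/

section Deviation

variable {L : ℕ} [NeZero L]

/-- **Energy above the free sector ground energy pays for every deviation from a Fermi sea.**
For `L ≥ 3` and a unit vector `ψ ∈ szSector (2n) 0` of the fermionic torus there are a Fermi set
`F` of `n` momenta and a Fermi level `ε_F` (`ε ≤ ε_F` on `F`, `ε_F ≤ ε` off `F`) with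
`Σ_k |ε_L(k) - ε_F| · dev_k ≤ Re ⟨ψ, H₀ ψ⟩ - minEnergyOn H₀ (szSector (2n) 0)`,
`dev_k = 1 - x_k` (`k ∈ F`, holes) resp. `x_k` (`k ∉ F`, particles), `x_k = Re ⟨ψ, n_{k↑} ψ⟩`,
`H₀ = hubbardTorus 2 L 1 0` (exact bathtub identity for `↑`, plain bathtub bound for `↓`, paired
trial state for the ground energy). Bardeen–Cooper–Schrieffer (1957) §II; Lieb–Loss (2001)
Thm 1.14. [folklore] -/
theorem exists_fermiSet_deviation_le_energy_excess (hL : 3 ≤ L) {n : ℕ}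
    {ψ : Fock (Orb (FermionTorus 2 L))} (hψ : ψ ∈ szSector (Λ := FermionTorus 2 L) (2 * n) 0)
    (h1 : star ψ ⬝ᵥ ψ = 1) :
    ∃ (F : Finset (TorusSite 2 L)) (eF : ℝ), F.card = n ∧ (∀ k ∈ F, torusBand L k ≤ eF) ∧
      (∀ k ∉ F, eF ≤ torusBand L k) ∧
      ∑ k : TorusSite 2 L, |torusBand L k - eF| *
          (if k ∈ F then 1 - (star ψ ⬝ᵥ (momentumNumber k 0 *ᵥ ψ)).re
            else (star ψ ⬝ᵥ (momentumNumber k 0 *ᵥ ψ)).re) ≤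
        (star ψ ⬝ᵥ (hubbardTorus 2 L 1 0 *ᵥ ψ)).re -
          (hubbardTorus 2 L 1 0).minEnergyOn (szSector (Λ := FermionTorus 2 L) (2 * n) 0) := by
  have hsec : IsInSector n n ψ := (mem_szSector_two_mul_zero_iff n ψ).1 hψ
  have h0 : ψ ≠ 0 := by rintro rfl; simp at h1
  obtain ⟨s, hs⟩ := Function.ne_iff.1 h0
  have hns : (upPart s).card = n := (not_imp_comm.1 (hsec s) hs).1
  have hn : n ≤ Fintype.card (TorusSite 2 L) := by
    rw [card_torusSite, ← hns]
    calc (upPart s).card ≤ (Finset.univ : Finset (FermionTorus 2 L)).card := Finset.card_le_univ _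
      _ = L ^ 2 := by simp
  obtain ⟨F, eF, hFc, hF, hF'⟩ := exists_fermiSet (torusBand L) hn
  refine ⟨F, eF, hFc, hF, hF', ?_⟩
  have hz0 : ∀ k : TorusSite 2 L, 0 ≤ (star ψ ⬝ᵥ (momentumNumber (-k) 1 *ᵥ ψ)).re := fun k =>
    (re_expect_momentumNumber_mem_Icc (-k) 1 ψ).1
  have hz1 : ∀ k : TorusSite 2 L, (star ψ ⬝ᵥ (momentumNumber (-k) 1 *ᵥ ψ)).re ≤ 1 := fun k => by
    have := (re_expect_momentumNumber_mem_Icc (-k) 1 ψ).2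
    rwa [h1, Complex.one_re] at this
  have hxs : ∑ k : TorusSite 2 L, (star ψ ⬝ᵥ (momentumNumber k 0 *ᵥ ψ)).re = F.card := by
    rw [hFc]
    have := sum_re_expect_momentumNumber_up (L := L) hsec
    rwa [h1, Complex.one_re, mul_one] at this
  have hzs : ∑ k : TorusSite 2 L, (star ψ ⬝ᵥ (momentumNumber (-k) 1 *ᵥ ψ)).re = F.card := by
    rw [hFc]
    have := sum_re_expect_momentumNumber_down (L := L) hsec
    rw [h1, Complex.one_re, mul_one] at this
    rw [← this]
    exact Equiv.sum_comp (Equiv.neg (TorusSite 2 L))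
      (fun k => (star ψ ⬝ᵥ (momentumNumber k 1 *ᵥ ψ)).re)
  -- the energy expectation over time-reversed pairs
  have hE : (star ψ ⬝ᵥ (hubbardTorus 2 L 1 0 *ᵥ ψ)).re =
      ∑ k : TorusSite 2 L, torusBand L k * (star ψ ⬝ᵥ (momentumNumber k 0 *ᵥ ψ)).re +
        ∑ k : TorusSite 2 L, torusBand L k * (star ψ ⬝ᵥ (momentumNumber (-k) 1 *ᵥ ψ)).re := by
    rw [← hubbardTorusWith_zero, hubbardTorusWith_zero_eq_sum_pairBlock_kinetic hL 0, Matrix.sum_mulVec,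
      dotProduct_sum, Complex.re_sum, ← Finset.sum_add_distrib]
    refine Finset.sum_congr rfl fun k _ => ?_
    rw [Matrix.smul_mulVec, dotProduct_smul, smul_eq_mul, Complex.re_ofReal_mul, add_mulVec,
      dotProduct_add, Complex.add_re, sub_zero]
    ring
  have hbx := sum_abs_sub_mul_deviation_eq (torusBand L)
    (fun k => (star ψ ⬝ᵥ (momentumNumber k 0 *ᵥ ψ)).re) F eF hF hF' hxs
  have hbz := sum_fermiSet_le (torusBand L) (fun k => (star ψ ⬝ᵥ (momentumNumber (-k) 1 *ᵥ ψ)).re)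
    F eF hF hF' hz0 hz1 hzs
  have hmin := minEnergyOn_szSector_hubbardTorus_zero_le hL F
  rw [hFc] at hmin
  rw [hE]
  linarith

/-- **Deviation bound for every Fermi set and every separating level.** For `L ≥ 3`, a unit
`ψ ∈ szSector (2n) 0`, ANY set `F` of `n` momenta and ANY level `ε_F` separating its band energies
from the others (`ε ≤ ε_F` on `F`, `ε_F ≤ ε` off `F`):
`Σ_k |ε_L(k) - ε_F| · dev_k ≤ Re ⟨ψ, H₀ ψ⟩ - minEnergyOn H₀ (szSector (2n) 0)` (same proof; the left
side does not depend on the choice of the separating level, `sum_abs_sub_mul_deviation_eq`). This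
form lets the consumer relocate `ε_F` inside a degenerate shell. Lieb–Loss (2001) Thm 1.14.
[folklore] -/
theorem sum_abs_sub_mul_deviation_le_energy_excess (hL : 3 ≤ L) {n : ℕ}
    {ψ : Fock (Orb (FermionTorus 2 L))} (hψ : ψ ∈ szSector (Λ := FermionTorus 2 L) (2 * n) 0)
    (h1 : star ψ ⬝ᵥ ψ = 1) (F : Finset (TorusSite 2 L)) (eF : ℝ) (hFc : F.card = n)
    (hF : ∀ k ∈ F, torusBand L k ≤ eF) (hF' : ∀ k ∉ F, eF ≤ torusBand L k) :
    ∑ k : TorusSite 2 L, |torusBand L k - eF| *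
        (if k ∈ F then 1 - (star ψ ⬝ᵥ (momentumNumber k 0 *ᵥ ψ)).re
          else (star ψ ⬝ᵥ (momentumNumber k 0 *ᵥ ψ)).re) ≤
      (star ψ ⬝ᵥ (hubbardTorus 2 L 1 0 *ᵥ ψ)).re -
        (hubbardTorus 2 L 1 0).minEnergyOn (szSector (Λ := FermionTorus 2 L) (2 * n) 0) := by
  have hsec : IsInSector n n ψ := (mem_szSector_two_mul_zero_iff n ψ).1 hψ
  have hz0 : ∀ k : TorusSite 2 L, 0 ≤ (star ψ ⬝ᵥ (momentumNumber (-k) 1 *ᵥ ψ)).re := fun k =>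
    (re_expect_momentumNumber_mem_Icc (-k) 1 ψ).1
  have hz1 : ∀ k : TorusSite 2 L, (star ψ ⬝ᵥ (momentumNumber (-k) 1 *ᵥ ψ)).re ≤ 1 := fun k => by
    have := (re_expect_momentumNumber_mem_Icc (-k) 1 ψ).2
    rwa [h1, Complex.one_re] at this
  have hxs : ∑ k : TorusSite 2 L, (star ψ ⬝ᵥ (momentumNumber k 0 *ᵥ ψ)).re = F.card := by
    rw [hFc]
    have := sum_re_expect_momentumNumber_up (L := L) hsec
    rwa [h1, Complex.one_re, mul_one] at this
  have hzs : ∑ k : TorusSite 2 L, (star ψ ⬝ᵥ (momentumNumber (-k) 1 *ᵥ ψ)).re = F.card := by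
    rw [hFc]
    have := sum_re_expect_momentumNumber_down (L := L) hsec
    rw [h1, Complex.one_re, mul_one] at this
    rw [← this]
    exact Equiv.sum_comp (Equiv.neg (TorusSite 2 L))
      (fun k => (star ψ ⬝ᵥ (momentumNumber k 1 *ᵥ ψ)).re)
  have hE : (star ψ ⬝ᵥ (hubbardTorus 2 L 1 0 *ᵥ ψ)).re =
      ∑ k : TorusSite 2 L, torusBand L k * (star ψ ⬝ᵥ (momentumNumber k 0 *ᵥ ψ)).re +
        ∑ k : TorusSite 2 L, torusBand L k * (star ψ ⬝ᵥ (momentumNumber (-k) 1 *ᵥ ψ)).re := by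
    rw [← hubbardTorusWith_zero, hubbardTorusWith_zero_eq_sum_pairBlock_kinetic hL 0, Matrix.sum_mulVec,
      dotProduct_sum, Complex.re_sum, ← Finset.sum_add_distrib]
    refine Finset.sum_congr rfl fun k _ => ?_
    rw [Matrix.smul_mulVec, dotProduct_smul, smul_eq_mul, Complex.re_ofReal_mul, add_mulVec,
      dotProduct_add, Complex.add_re, sub_zero]
    ring
  have hbx := sum_abs_sub_mul_deviation_eq (torusBand L)
    (fun k => (star ψ ⬝ᵥ (momentumNumber k 0 *ᵥ ψ)).re) F eF hF hF' hxs
  have hbz := sum_fermiSet_le (torusBand L) (fun k => (star ψ ⬝ᵥ (momentumNumber (-k) 1 *ᵥ ψ)).re)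
    F eF hF hF' hz0 hz1 hzs
  have hmin := minEnergyOn_szSector_hubbardTorus_zero_le hL F
  rw [hFc] at hmin
  rw [hE]
  linarith

end Deviation

end Literature.MathematicalPhysics.QuantumLattice
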